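import Mathlib
import Literature.NumberTheory.LFunctions.Zhang2022.Section11AFEWideWindowCore
import HarnessLib

/-!
# Zhang (2022) §11, proof of Lemma 11.2 for `χψ` on the WIDENED height range `|t − 2πt₀| < 𝓛₁ + 2`
# — the contour move (6.5), node level (`windowMove11_wide`)

Topic `Literature/NumberTheory/LFunctions/Zhang2022` (Landau–Siegel audit tree; verdict-neutral).
Y. Zhang, *Discrete mean estimates and the Landau–Siegel zero*, arXiv:2211.02515v1 (2022)
[Zhang2022LandauSiegel] — **an unrefereed manuscript under adjudication** (campaign D-0069 /
ZHANG-L discharge lane, WP12 helper H2-B; nothing here bears on Theorems 1–2 or on Landau–Siegel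
zeros). Companion of `Section11AFEWindowBounds` / `Section11AFEWindowMove` (sub-step (f)
`WindowMove11` of `Z22:§11.u024`, the §6 step (6.5) for `χψ`).

WHY. §12 p. 67 (tex L3426–3429, `Z22:§12.u009`) applies "the proof of Lemma 11.2 with `s + β₆` in
place of `s`"; `s + β₆` leaves the typed range `InRange112` (`|t − 2πt₀| < 𝓛₁`) by up to `3α/2`. The
§11 proof uses the height only through `4𝓛⁵¹⁹ ≤ t − 𝓛²⁰` and `t ≤ 8𝓛⁵¹⁹`, both true on
`|t − 2πt₀| < 𝓛₁ + 2`; this file re-runs (f) VERBATIM with `InRange112 D s` replaced by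
`InRange61 D s ∧ σ = 1/2` (twins, suffix `_wide`). Theorem-only; 0 new definitions, 0 new facts.

* (companion `Section11AFEWideWindowCore`: `windowMove11_core_wide`, explicit constants);
* `windowMove11_wide` — twin of `windowMove11_holds`: for `D ≥ ⌈e¹¹²⌉`, `ψ ∈ Ψ`, `σ = 1/2`,
  `|t − 2πt₀| < 𝓛₁ + 2`, `0.5 ≤ z ≤ 0.504`:
  `‖∫_{(−1)}I″ − ∫_{−i𝓛²⁰}^{i𝓛²⁰}I″‖ ≤ C·exp{−𝓛¹⁰/16}`.

## References

* Y. Zhang, arXiv:2211.02515v1 (2022), §6 proof of Lemma 6.1, (6.5) p. 32; §11 Lemma 11.2 p. 65;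
  §12 p. 67. [cite: Zhang2022LandauSiegel, §6 (6.5); §11 Lemma 11.2; §12 p.67]
-/

noncomputable section

open Complex Real ComplexConjugate MeasureTheory Set Filter Topology

namespace Literature.NumberTheory.LFunctions.Zhang2022.Section11AFE

open Skeleton GaussWeight Section6Statements

section BlockFWide

variable {D : ℕ} [NeZero D] (χ : DirichletCharacter ℂ D) (x : Chr D)

/-! ## §1. The constants and the widened node -/

omit [NeZero D] in
/-- Powers of `𝓛` against `e^{𝓛⁹}`: `𝓛ⁿ ≤ e^{𝓛⁹}` for `n ≤ 𝓛⁸` (`𝓛 ≥ 1`). [folklore] -/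
private theorem pow_le_exp_pow_nine {L : ℝ} (hL : 1 ≤ L) {n : ℕ} (hn : (n : ℝ) ≤ L ^ 8) :
    L ^ n ≤ Real.exp (L ^ 9) := by
  have h1 : L ≤ Real.exp L := by have := Real.add_one_le_exp L; linarith
  have h0 : 0 ≤ L := by linarith
  calc L ^ n ≤ Real.exp L ^ n := pow_le_pow_left₀ h0 h1 n
    _ = Real.exp (n * L) := by rw [← Real.exp_nat_mul]
    _ ≤ Real.exp (L ^ 9) := Real.exp_le_exp.mpr (by
        calc (n : ℝ) * L ≤ L ^ 8 * L := mul_le_mul_of_nonneg_right hn h0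
          _ = L ^ 9 := by ring)

omit [NeZero D] in
/-- The constant bookkeeping of (f): with `E = e^{𝓛⁹}` and every `D`-dependent atom `≤ O(E^{O(1)})`,
the bound of `windowMove11_core` is `≤ C·e^{−𝓛¹⁰/16}` once `𝓛 ≥ 112`. [folklore] -/
private theorem windowMove11_consts {L G k2 R Nn Xi eb e8 e4 binv s4 s2 A2 tV2 : ℝ} (hL : 112 ≤ L)
    (hG0 : 0 ≤ G) (hk2 : 0 ≤ k2) (hk2' : k2 ≤ 9 * Real.exp (L ^ 9) ^ 4) (hR : 0 ≤ R)
    (hR' : R ≤ Real.exp (L ^ 9) ^ 3) (hNn : 0 ≤ Nn) (hNn' : Nn ≤ 2 * Real.exp (L ^ 9)) (hXi : 0 ≤ Xi)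
    (hXi' : Xi ≤ 1) (heb : 0 ≤ eb) (heb' : eb ≤ 3) (he8 : 0 ≤ e8) (he8' : e8 ≤ Real.exp (-(L ^ 10 / 8)))
    (he4 : 0 ≤ e4) (he4' : e4 ≤ Real.exp (-(L ^ 10 / 8))) (hbinv : 0 ≤ binv)
    (hbinv' : binv ≤ 16 * Real.exp (L ^ 9)) (hs4 : 0 ≤ s4) (hs4' : s4 ≤ 8 * Real.exp (L ^ 9))
    (hs2 : 0 ≤ s2) (hs2' : s2 ≤ 6 * Real.exp (L ^ 9)) (hA2 : 0 ≤ A2) (hA2' : A2 ≤ 100 * Real.exp (L ^ 9))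
    (htV2 : 0 ≤ tV2) (htV2' : tV2 ≤ 81 * Real.exp (L ^ 9)) :
    (G * k2 + R) * Nn * (Xi * eb) * (e8 * (binv * s4 + 2 * A2 * s2)) +
        2 * ((4 * k2 * tV2 + R) * Nn * eb * e4) ≤
      (7968 * (9 * G + 1) + 35004) * Real.exp (-(1 / 16) * L ^ 10) := by
  set E : ℝ := Real.exp (L ^ 9) with hE
  have hE1 : 1 ≤ E := Real.one_le_exp (by positivity)
  have hL0 : 0 < L := by linarith
  set q : ℝ := Real.exp (-(L ^ 10 / 8)) with hq
  have hq0 : 0 ≤ q := Real.exp_nonneg _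
  have hE34 : E ^ 3 ≤ E ^ 4 := pow_le_pow_right₀ hE1 (by norm_num)
  have hE35 : E ^ 3 ≤ E ^ 5 := pow_le_pow_right₀ hE1 (by norm_num)
  have hE67 : E ^ 6 ≤ E ^ 7 := pow_le_pow_right₀ hE1 (by norm_num)
  have h1 : G * k2 + R ≤ (9 * G + 1) * E ^ 4 := by
    nlinarith [mul_le_mul_of_nonneg_left hk2' hG0]
  have h1' : 0 ≤ G * k2 + R := by positivity
  have h2 : 4 * k2 * tV2 + R ≤ 2917 * E ^ 5 := by
    have : 4 * k2 * tV2 ≤ 4 * (9 * E ^ 4) * (81 * E) := by gcongr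
    nlinarith
  have h2' : 0 ≤ 4 * k2 * tV2 + R := by positivity
  have hM : binv * s4 + 2 * A2 * s2 ≤ 1328 * E ^ 2 := by
    have ha : binv * s4 ≤ 16 * E * (8 * E) := by gcongr
    have hb : 2 * A2 * s2 ≤ 2 * (100 * E) * (6 * E) := by gcongr
    nlinarith
  have hM' : 0 ≤ binv * s4 + 2 * A2 * s2 := by positivity
  have hfin : E ^ 7 * q ≤ Real.exp (-(1 / 16) * L ^ 10) := by
    rw [hE, hq, ← Real.exp_nat_mul, ← Real.exp_add]
    refine Real.exp_le_exp.mpr ?_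
    have h9 : L ^ 10 = L * L ^ 9 := by ring
    nlinarith [pow_nonneg hL0.le 9]
  calc (G * k2 + R) * Nn * (Xi * eb) * (e8 * (binv * s4 + 2 * A2 * s2)) +
        2 * ((4 * k2 * tV2 + R) * Nn * eb * e4)
      ≤ ((9 * G + 1) * E ^ 4) * (2 * E) * (1 * 3) * (q * (1328 * E ^ 2)) +
        2 * ((2917 * E ^ 5) * (2 * E) * 3 * q) := by
        gcongr
    _ = (7968 * (9 * G + 1) * E ^ 7 + 35004 * E ^ 6) * q := by ring
    _ ≤ (7968 * (9 * G + 1) * E ^ 7 + 35004 * E ^ 7) * q := by gcongr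
    _ = (7968 * (9 * G + 1) + 35004) * (E ^ 7 * q) := by ring
    _ ≤ (7968 * (9 * G + 1) + 35004) * Real.exp (-(1 / 16) * L ^ 10) := by gcongr

omit [NeZero D] in
/-- The `𝓛`-only atoms of (f): Gaussian widths and the two exponentials (`b = 1/(4𝓛³⁰)`, `V = 𝓛²⁰`).
[folklore] -/
private theorem windowMove11_Latoms {L : ℝ} (hL1 : 1 ≤ L) :
    Real.sqrt (π / (1 / (4 * L ^ 30) / 4)) ≤ 8 * L ^ 15 ∧
      Real.sqrt (π / (1 / (4 * L ^ 30) / 2)) ≤ 6 * L ^ 15 ∧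
      4 / (1 / (4 * L ^ 30)) = 16 * L ^ 30 ∧
      Real.exp (1 / (4 * L ^ 30)) ≤ 3 ∧
      Real.exp (-(1 / (4 * L ^ 30) / 2) * (L ^ 20) ^ 2) ≤ Real.exp (-(L ^ 10 / 8)) ∧
      Real.exp (-(1 / (4 * L ^ 30)) * (L ^ 20) ^ 2) ≤ Real.exp (-(L ^ 10 / 8)) := by
  have hL0 : 0 < L := by linarith
  have h30 : 0 < L ^ 30 := by positivity
  have h15 : 0 ≤ L ^ 15 := by positivity
  have h1530 : (L ^ 15) ^ 2 = L ^ 30 := by ring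
  have hπ := Real.pi_lt_four
  refine ⟨?_, ?_, ?_, ?_, ?_, ?_⟩
  · have e : π / (1 / (4 * L ^ 30) / 4) = 16 * π * L ^ 30 := by field_simp; ring
    rw [e]
    have h : 16 * π * L ^ 30 ≤ (8 * L ^ 15) ^ 2 := by
      rw [mul_pow, h1530]; exact mul_le_mul_of_nonneg_right (by linarith) h30.le
    calc Real.sqrt (16 * π * L ^ 30) ≤ Real.sqrt ((8 * L ^ 15) ^ 2) := Real.sqrt_le_sqrt h
      _ = 8 * L ^ 15 := Real.sqrt_sq (by positivity)
  · have e : π / (1 / (4 * L ^ 30) / 2) = 8 * π * L ^ 30 := by field_simp; ring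
    rw [e]
    have h : 8 * π * L ^ 30 ≤ (6 * L ^ 15) ^ 2 := by
      rw [mul_pow, h1530]; exact mul_le_mul_of_nonneg_right (by linarith) h30.le
    calc Real.sqrt (8 * π * L ^ 30) ≤ Real.sqrt ((6 * L ^ 15) ^ 2) := Real.sqrt_le_sqrt h
      _ = 6 * L ^ 15 := Real.sqrt_sq (by positivity)
  · field_simp; ring
  · have h1 : (1 : ℝ) ≤ L ^ 30 := one_le_pow₀ hL1
    have : 1 / (4 * L ^ 30) ≤ 1 := by rw [div_le_one (by positivity)]; linarith
    calc Real.exp (1 / (4 * L ^ 30)) ≤ Real.exp 1 := Real.exp_le_exp.mpr this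
      _ ≤ 3 := by have := Real.exp_one_lt_d9; linarith
  · refine le_of_eq ?_; congr 1; field_simp; ring
  · refine Real.exp_le_exp.mpr ?_
    have e : -(1 / (4 * L ^ 30)) * (L ^ 20) ^ 2 = -(L ^ 10 / 4) := by field_simp
    rw [e]
    have : 0 ≤ L ^ 10 := by positivity
    linarith

set_option maxHeartbeats 400000 in
/-- **(f) on the widened range** (twin of `windowMove11_holds`, `c = 1/16`, `D ≥ e^{112}`): for
`ψ ∈ Ψ`, `σ = 1/2`, `|t − 2πt₀| < 𝓛₁ + 2`, `0.5 ≤ z ≤ 0.504`, the segment `u = −1`, `|v| ≤ 𝓛²⁰` of the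
`I″`-integral is moved to `u = 0`, `|v| ≤ 𝓛²⁰` at cost `C·e^{−𝓛¹⁰/16}`.
[cite: Zhang2022LandauSiegel, §6 (6.5) p. 32; §11 p. 65; §12 p. 67] -/
theorem windowMove11_wide :
    ∃ c : ℝ, 0 < c ∧ ∃ C : ℝ, ForAllLarge fun D _ χ => ∀ x : Chr D, ∀ s : ℂ, s.re = 1 / 2 →
      |s.im - 2 * π * t0 D| < ell1 D + 2 → ∀ z : ℝ, 0.5 ≤ z → z ≤ 0.504 →
        ‖vline (integrandDiff χ x (bigP D ^ z) (Skeleton.P1 D) s) (-1) -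
            vseg (integrandDiff χ x (bigP D ^ z) (Skeleton.P1 D) s) 0 (ell D ^ 20)‖
          ≤ C * Real.exp (-c * ell D ^ 10) := by
  obtain ⟨G, hG0, hG⟩ := StripGrowth.exists_norm_Zfac_le (A := 1) le_rfl
  refine ⟨1 / 16, by norm_num, 7968 * (9 * G + 1) + 35004, ⌈Real.exp 112⌉₊,
    fun D _ χ hD _hq hp x s hre him z hz1 _hz2 => ?_⟩
  -- `𝓛 ≥ 112`
  have hexp : Real.exp 112 ≤ D := le_trans (Nat.le_ceil _) (by exact_mod_cast hD)
  have hL : 112 ≤ ell D := (Real.le_log_iff_exp_le (lt_of_lt_of_le (Real.exp_pos _) hexp)).mpr hexp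
  have hD3 : 3 ≤ D := by
    have h3 : (3 : ℝ) ≤ Real.exp 112 := by have := Real.add_one_le_exp (112 : ℝ); linarith
    exact_mod_cast h3.trans hexp
  have hD9 : 9 ≤ D := by
    have h9 : (9 : ℝ) ≤ Real.exp 112 := by have := Real.add_one_le_exp (112 : ℝ); linarith
    exact_mod_cast h9.trans hexp
  have hr61 : InRange61 D s := by
    have hℓ : 0 < ell D := by linarith
    have hα : 0 < alpha D := by
      rw [Section2.alpha_eq_pi_div_ell9]; exact div_pos Real.pi_pos (pow_pos hℓ 9)
    refine ⟨?_, him⟩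
    rw [hre, sub_self, abs_zero]
    linarith
  have hcore := windowMove11_core_wide χ x hG0.le hG hD3 hp (by linarith) hr61 hre hz1
  refine hcore.trans ?_
  set L : ℝ := ell D with hLdef
  have hL1 : 1 ≤ L := by linarith
  have hL0 : 0 < L := by linarith
  obtain ⟨hs4, hs2, hbinv, hb1, hE8, hE4⟩ := windowMove11_Latoms hL1
  set E : ℝ := Real.exp (L ^ 9) with hEdef
  have hE0 : 0 < E := Real.exp_pos _
  have hE1 : 1 ≤ E := Real.one_le_exp (pow_nonneg hL0.le 9)
  have hP : bigP D = E := rfl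
  have hDexp : (D : ℝ) = Real.exp L := by
    rw [hLdef, ell, Real.exp_log]; exact_mod_cast lt_of_lt_of_le (by norm_num) hD3
  have hDE : (D : ℝ) ≤ E := by
    rw [hDexp, hEdef]; refine Real.exp_le_exp.mpr ?_
    calc L = L ^ 1 := (pow_one L).symm
      _ ≤ L ^ 9 := pow_le_pow_right₀ hL1 (by norm_num)
  have hL8 : (2000 : ℝ) ≤ L ^ 8 := by
    calc (2000 : ℝ) ≤ 112 ^ 2 := by norm_num
      _ ≤ L ^ 2 := pow_le_pow_left₀ (by norm_num) hL 2
      _ ≤ L ^ 8 := pow_le_pow_right₀ hL1 (by norm_num)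
  have hpow : ∀ n : ℕ, (n : ℝ) ≤ 2000 → L ^ n ≤ E := fun n hn =>
    pow_le_exp_pow_nine hL1 (hn.trans hL8)
  -- the `D`-dependent atoms
  have hp3 : (x.p : ℝ) ≤ 3 * E := by rw [← hP]; exact chr_p_le_three_mul_bigP x (by linarith)
  have hk : ((D * x.p : ℕ) : ℝ) ≤ 3 * E ^ 2 := by
    push_cast
    calc (D : ℝ) * x.p ≤ E * (3 * E) := mul_le_mul hDE hp3 (Nat.cast_nonneg _) hE0.le
      _ = 3 * E ^ 2 := by ring
  have hk2 : ((D * x.p : ℕ) : ℝ) ^ 2 ≤ 9 * E ^ 4 := by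
    calc ((D * x.p : ℕ) : ℝ) ^ 2 ≤ (3 * E ^ 2) ^ 2 := pow_le_pow_left₀ (Nat.cast_nonneg _) hk 2
      _ = 9 * E ^ 4 := by ring
  have ht0 : t0 D = L ^ 519 := rfl
  have h519 : 0 ≤ L ^ 519 := pow_nonneg hL0.le 519
  have hR0 : 0 ≤ bigR D := by
    rw [bigR, ht0, hP]; exact mul_nonneg (mul_nonneg (Nat.cast_nonneg _) hE0.le) h519
  have hRle : bigR D ≤ E ^ 3 := by
    rw [bigR, ht0, hP]
    calc (D : ℝ) * E * L ^ 519 ≤ E * E * E :=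
          mul_le_mul (mul_le_mul_of_nonneg_right hDE hE0.le) (hpow 519 (by norm_num)) h519
            (mul_nonneg hE0.le hE0.le)
      _ = E ^ 3 := by ring
  have hP10 : 0 ≤ Skeleton.P1 D := by rw [Skeleton.P1, hP]; exact Real.rpow_nonneg hE0.le _
  have hN : (⌈Skeleton.P1 D⌉₊ : ℝ) ≤ 2 * E := by
    have hP1le : Skeleton.P1 D ≤ E := by
      rw [Skeleton.P1, hP]
      calc E ^ (0.504 : ℝ) ≤ E ^ (1 : ℝ) := Real.rpow_le_rpow_of_exponent_le hE1 (by norm_num)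
        _ = E := Real.rpow_one E
    have h' : (⌈Skeleton.P1 D⌉₊ : ℝ) < Skeleton.P1 D + 1 := Nat.ceil_lt_add_one hP10
    linarith
  have hX1 : 1 ≤ bigP D ^ z := by rw [hP]; exact Real.one_le_rpow hE1 (by linarith)
  have hXinv : (bigP D ^ z)⁻¹ ≤ 1 := inv_le_one_of_one_le₀ hX1
  have hXinv0 : 0 ≤ (bigP D ^ z)⁻¹ := inv_nonneg.mpr (by linarith)
  -- `|t| ≤ 8 L⁵¹⁹`
  have htabs : |s.im| ≤ 8 * L ^ 519 := by
    have h := abs_lt.mp him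
    rw [ell1, ht0] at h
    have h405 : L ^ 405 ≤ L ^ 519 := pow_le_pow_right₀ hL1 (by norm_num)
    have h2pi : 2 * π * L ^ 519 ≤ 7 * L ^ 519 := by
      have : 2 * π ≤ 7 := by linarith [Real.pi_lt_d2]
      exact mul_le_mul_of_nonneg_right this h519
    rw [← hLdef] at h
    have hL2 : (2 : ℝ) ≤ L := by linarith
    have hL405 : (2 : ℝ) ≤ L ^ 405 := le_trans hL2 (le_self_pow₀ hL1 (by norm_num))
    have h405' : L ^ 405 + 2 ≤ L ^ 519 :=
      calc L ^ 405 + 2 ≤ L ^ 405 + L ^ 405 := by linarith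
        _ ≤ L * L ^ 405 := by nlinarith
        _ = L ^ 406 := by ring
        _ ≤ L ^ 519 := pow_le_pow_right₀ hL1 (by norm_num)
    have hlow : 0 ≤ s.im := by
      have : 6 * L ^ 519 ≤ 2 * π * L ^ 519 :=
        mul_le_mul_of_nonneg_right (by linarith [Real.pi_gt_three]) h519
      linarith [h.1]
    rw [abs_of_nonneg hlow]; linarith [h.2]
  have h1038 : L ^ 1038 ≤ E := hpow 1038 (by norm_num)
  have htV : (|s.im| + |L ^ 20|) ^ 2 ≤ 81 * E := by
    have h20 : |L ^ 20| ≤ L ^ 519 := by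
      rw [abs_of_nonneg (pow_nonneg hL0.le 20)]; exact pow_le_pow_right₀ hL1 (by norm_num)
    have h1 : |s.im| + |L ^ 20| ≤ 9 * L ^ 519 := by linarith
    have h0 : 0 ≤ |s.im| + |L ^ 20| := by positivity
    calc (|s.im| + |L ^ 20|) ^ 2 ≤ (9 * L ^ 519) ^ 2 := pow_le_pow_left₀ h0 h1 2
      _ = 81 * L ^ 1038 := by ring
      _ ≤ 81 * E := by linarith
  have hA2 : (|s.im| + 2) ^ 2 ≤ 100 * E := by
    have h1 : |s.im| + 2 ≤ 10 * L ^ 519 := by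
      have : (1 : ℝ) ≤ L ^ 519 := one_le_pow₀ hL1
      linarith
    calc (|s.im| + 2) ^ 2 ≤ (10 * L ^ 519) ^ 2 := pow_le_pow_left₀ (by positivity) h1 2
      _ = 100 * L ^ 1038 := by ring
      _ ≤ 100 * E := by linarith
  have h15 : L ^ 15 ≤ E := hpow 15 (by norm_num)
  have h30 : L ^ 30 ≤ E := hpow 30 (by norm_num)
  rw [hbinv]
  exact windowMove11_consts hL hG0.le (by positivity) hk2 hR0 hRle (Nat.cast_nonneg _) hN hXinv0
    hXinv (Real.exp_nonneg _) hb1 (Real.exp_nonneg _) hE8 (Real.exp_nonneg _) hE4 (by positivity)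
    (by linarith) (Real.sqrt_nonneg _) (hs4.trans (by linarith)) (Real.sqrt_nonneg _)
    (hs2.trans (by linarith)) (by positivity) hA2 (by positivity) htV

end BlockFWide

end Literature.NumberTheory.LFunctions.Zhang2022.Section11AFE
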